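import Mathlib
import HarnessLib
import Literature.Analysis.FluidPDE.AxisymmetricEuler
import Summits.NavierStokesRegularity.NavierStokesRegularity.Theorems.PoloidalWindowRigidity.Negative.HelicityFree
import Summits.NavierStokesRegularity.NavierStokesRegularity.Theorems.PoloidalWindowRigidity.Negative.SwirlEveryAxis

/-!
# Crux `PoloidalWindowRigidity` (K2, stmt-NavierStokesRegularity-19708) — negative side:
# the drifting cellular witness lies OFF ALL FOUR symmetry strata of the helicity door's slice classification

Negative-side support (refuter seat ns-regularity-refuter1, cell ns-regularity-ideate; D-0081 §C). Cross-door record for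
the helicity door (route `LocalTubeDoorHelicity`, crux K2⁗ `FrobeniusProfileRigidity`, stub `SliceQuadrichotomy`, nsreg-p1
ROUND-12/13): the slice quadrichotomy asks that a Type-I, Oseen-mild, divergence-free, helicity-free profile have SOME
slice `s < 0` on which (1) the vorticity is parallel to a fixed direction, or (2) the slice is translation-invariant
along a line, or (3) it is axisymmetric without swirl in some rigid frame, or (4) its vorticity is an affine screw field
`k (d × (y − c) + h d)` on a non-empty open set.

* `driftProfile_no_affineScrew_vorticity_ball`: (4) fails on every slice of the drifting cellular profile `w` — the first
  vorticity component `c(s)²·2 sin Y₂ cos Y₁` (`Y = c(s)y + log(−s)e₁`) has a non-zero second difference along `e₁` at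
  a point of any ball, whereas an affine field has none (no use of `k ≠ 0`, `d ≠ 0`).
* `sliceQuadrichotomy_false_without_mild`: together with `helicityFree_driftProfile`,
  `driftProfile_no_aligned_no_translationInvariant_slice` ((1), (2)) and `driftProfile_swirl_every_axis` ((3)), the
  slice quadrichotomy with the Oseen-mild clause deleted from the class is FALSE: `w` is Type-I (`C = 4`), jointly
  continuous, divergence-free, helicity-free and BOUNDED on every slice, and lies off all four strata on every slice.
  So — as for K2 — every version of the classification must use the Navier–Stokes (Oseen-mild) identity; growth or
  boundedness conditions alone do not place a complex-lamellar profile on a stratum. [folklore]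
-/

noncomputable section

namespace Summit.NavierStokesRegularity.NavierStokesRegularity.Theorems.PoloidalWindowRigidity.Negative

open Set Function
open scoped RealInnerProductSpace InnerProductSpace
open Literature.Analysis Literature.Analysis.FluidPDE

/-- A step `t ∈ (0, r)` with `sin (c t) ≠ 0` and `cos (c t) ≠ 1` (`c, r > 0`). [folklore] -/
theorem exists_small_step {c r : ℝ} (hc : 0 < c) (hr : 0 < r) :
    ∃ t : ℝ, 0 < t ∧ t < r ∧ Real.sin (c * t) ≠ 0 ∧ Real.cos (c * t) ≠ 1 := by
  have hct : 0 < c * min (r / 2) (Real.pi / (2 * c)) := by positivity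
  have hct' : c * min (r / 2) (Real.pi / (2 * c)) < Real.pi := by
    calc c * min (r / 2) (Real.pi / (2 * c)) ≤ c * (Real.pi / (2 * c)) :=
          mul_le_mul_of_nonneg_left (min_le_right _ _) hc.le
      _ = Real.pi / 2 := by field_simp
      _ < Real.pi := by linarith [Real.pi_pos]
  refine ⟨min (r / 2) (Real.pi / (2 * c)), lt_min (by positivity) (by positivity),
    lt_of_le_of_lt (min_le_left _ _) (by linarith), (Real.sin_pos_of_pos_of_lt_pi hct hct').ne', ?_⟩
  intro h1
  have h0 := (Real.cos_eq_one_iff_of_lt_of_lt (by linarith [Real.pi_pos]) (by linarith [Real.pi_pos])).1 h1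
  exact hct.ne' h0

/-- A small forward shift makes `sin` non-zero: `∃ t ∈ [0, r)`, `sin (θ + c t) ≠ 0`. [folklore] -/
theorem exists_shift_sin_ne_zero (θ : ℝ) {c r : ℝ} (hc : 0 < c) (hr : 0 < r) :
    ∃ t : ℝ, 0 ≤ t ∧ t < r ∧ Real.sin (θ + c * t) ≠ 0 := by
  by_cases h : Real.sin θ = 0
  · obtain ⟨t, ht0, htr, hsin, -⟩ := exists_small_step hc hr
    have hcos : Real.cos θ ≠ 0 := by
      intro h0
      have h2 := Real.sin_sq_add_cos_sq θ
      rw [h, h0] at h2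
      norm_num at h2
    refine ⟨t, ht0.le, htr, ?_⟩
    rw [Real.sin_add, h, zero_mul, zero_add]
    exact mul_ne_zero hcos hsin
  · exact ⟨0, le_rfl, hr, by simpa using h⟩

/-- A small forward shift makes `cos` non-zero: `∃ t ∈ [0, r)`, `cos (θ + c t) ≠ 0`. [folklore] -/
theorem exists_shift_cos_ne_zero (θ : ℝ) {c r : ℝ} (hc : 0 < c) (hr : 0 < r) :
    ∃ t : ℝ, 0 ≤ t ∧ t < r ∧ Real.cos (θ + c * t) ≠ 0 := by
  by_cases h : Real.cos θ = 0
  · obtain ⟨t, ht0, htr, hsin, -⟩ := exists_small_step hc hr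
    have hsinθ : Real.sin θ ≠ 0 := by
      intro h0
      have h2 := Real.sin_sq_add_cos_sq θ
      rw [h, h0] at h2
      norm_num at h2
    refine ⟨t, ht0.le, htr, ?_⟩
    rw [Real.cos_add, h, zero_mul, zero_sub]
    exact neg_ne_zero.2 (mul_ne_zero hsinθ hsin)
  · exact ⟨0, le_rfl, hr, by simpa using h⟩

/-- **Alternative (4) fails for the K2 witness**: on no slice `s < 0` is the vorticity of the drifting cellular profile
an affine screw field `k (d × (y − c) + h d)` on a non-empty open set. [folklore] -/
theorem driftProfile_no_affineScrew_vorticity_ball {s : ℝ} (hs : s < 0) :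
    ¬ ∃ (k : ℝ) (c d : EuclideanSpace ℝ (Fin 3)) (h : ℝ) (U : Set (EuclideanSpace ℝ (Fin 3))),
      k ≠ 0 ∧ d ≠ 0 ∧ IsOpen U ∧ U.Nonempty ∧
        ∀ y ∈ U, curl (driftProfile s) y = k • (cross d (y - c) + h • d) := by
  rintro ⟨k, c, d, h, U, -, -, hU, ⟨y₀, hy₀⟩, hcurl⟩
  obtain ⟨r, hr, hball⟩ := Metric.isOpen_iff.1 hU y₀ hy₀
  have hc := cellAmp_pos hs
  have hr4 : 0 < r / 4 := by positivity
  obtain ⟨t₂, ht₂0, ht₂r, hsin2⟩ := exists_shift_sin_ne_zero (cellAmp s * y₀ 2) hc hr4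
  obtain ⟨t₁, ht₁0, ht₁r, hcos1⟩ := exists_shift_cos_ne_zero (cellAmp s * y₀ 1 + Real.log (-s)) hc hr4
  obtain ⟨ε, hε0, hεr, -, hcosε⟩ := exists_small_step hc hr4
  set e1 : EuclideanSpace ℝ (Fin 3) := EuclideanSpace.single 1 (1 : ℝ) with he1
  set e2 : EuclideanSpace ℝ (Fin 3) := EuclideanSpace.single 2 (1 : ℝ) with he2
  set y : EuclideanSpace ℝ (Fin 3) := y₀ + t₂ • e2 + t₁ • e1 with hy
  -- the segment `y + l e₁`, `|l| < r/4`, lies in `U`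
  have mem : ∀ l : ℝ, |l| < r / 4 → y + l • e1 ∈ U := by
    intro l hl
    apply hball
    rw [Metric.mem_ball, dist_eq_norm]
    have hv : y + l • e1 - y₀ = t₂ • e2 + t₁ • e1 + l • e1 := by rw [hy]; abel
    calc ‖y + l • e1 - y₀‖ = ‖t₂ • e2 + t₁ • e1 + l • e1‖ := by rw [hv]
      _ ≤ ‖t₂ • e2‖ + ‖t₁ • e1‖ + ‖l • e1‖ := norm_add₃_le
      _ = |t₂| + |t₁| + |l| := by simp [he1, he2, norm_smul]
      _ < r := by rw [abs_of_nonneg ht₂0, abs_of_nonneg ht₁0]; linarith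
  -- coordinates of `y`
  have hy2 : y 2 = y₀ 2 + t₂ := by simp [hy, he1, he2]
  have hy1 : y 1 = y₀ 1 + t₁ := by simp [hy, he1, he2]
  have hY2 : driftShift s y 2 = cellAmp s * y₀ 2 + cellAmp s * t₂ := by
    rw [driftShift_apply_two, hy2]; ring
  have hY1 : driftShift s y 1 = cellAmp s * y₀ 1 + Real.log (-s) + cellAmp s * t₁ := by
    rw [driftShift_apply_one, hy1]; ring
  -- the first vorticity component along the segment
  have ev : ∀ l : ℝ, |l| < r / 4 →
      cellAmp s ^ 2 * (2 * Real.sin (driftShift s y 2) * Real.cos (driftShift s y 1 + cellAmp s * l)) =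
        k * (d 1 * (y 2 - c 2) - d 2 * (y 1 + l - c 1) + h * d 0) := by
    intro l hl
    have h1 := congrArg (fun v : EuclideanSpace ℝ (Fin 3) => v 0) (hcurl _ (mem l hl))
    simp only at h1
    rw [curl_driftProfile_apply_zero, driftShift_add_smul] at h1
    simp [cross, cross_apply, he1] at h1
    linear_combination h1
  have A0 := ev 0 (by simpa using hr4)
  have Ap := ev ε (by rwa [abs_of_pos hε0])
  have Am := ev (-ε) (by rwa [abs_neg, abs_of_pos hε0])
  simp only [mul_zero, add_zero] at A0
  simp only [mul_neg, Real.cos_add, Real.sin_neg, Real.cos_neg] at Ap Am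
  have key : cellAmp s ^ 2 * (2 * Real.sin (driftShift s y 2)) * (2 * Real.cos (driftShift s y 1)) *
      (Real.cos (cellAmp s * ε) - 1) = 0 := by
    linear_combination Ap + Am - 2 * A0
  have hne : cellAmp s ^ 2 * (2 * Real.sin (driftShift s y 2)) * (2 * Real.cos (driftShift s y 1)) *
      (Real.cos (cellAmp s * ε) - 1) ≠ 0 := by
    refine mul_ne_zero (mul_ne_zero (mul_ne_zero (pow_ne_zero 2 hc.ne') ?_) ?_) (sub_ne_zero.2 hcosε)
    · rw [hY2]; exact mul_ne_zero two_ne_zero hsin2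
    · rw [hY1]; exact mul_ne_zero two_ne_zero hcos1
  exact hne key

/-- **The slice quadrichotomy without the Oseen-mild clause is FALSE.** With `(M)` deleted from the Frobenius class
(keeping the Type-I rate, joint continuity, divergence-freeness and helicity-freeness `v · curl v ≡ 0`), the drifting
cellular profile is a member none of whose slices `s < 0` lies on any of the four strata (vorticity-aligned /
translation-invariant along a line / axisymmetric without swirl in some frame / affine screw vorticity on an open set).
Hence the classification stub of the helicity door has no kinematic content: any proof must use `(M)`, exactly as for
the K2 residue (`residueNoScrewNoGauge_false_with_classRates_without_mild`). [folklore] -/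
theorem sliceQuadrichotomy_false_without_mild :
    ¬ ∀ (C : ℝ) (v : ℝ → EuclideanSpace ℝ (Fin 3) → EuclideanSpace ℝ (Fin 3)),
      (HasTypeITimeDecay C v ∧
        ContinuousOn (Function.uncurry v) (Set.Iio (0 : ℝ) ×ˢ Set.univ) ∧
        (∀ t < 0, VectorCalculus.IsDivFree (v t)) ∧
        (∀ s < 0, ∀ y : EuclideanSpace ℝ (Fin 3), inner ℝ (v s y) (curl (v s) y) = 0)) →
      ∃ s < 0,
        (∃ b : EuclideanSpace ℝ (Fin 3), b ≠ 0 ∧ ∀ y, cross (curl (v s) y) b = 0) ∨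
        (∃ e : EuclideanSpace ℝ (Fin 3), e ≠ 0 ∧
          ∀ (y : EuclideanSpace ℝ (Fin 3)) (l : ℝ), v s (y + l • e) = v s y) ∨
        (∃ (L : EuclideanSpace ℝ (Fin 3) ≃ₗᵢ[ℝ] EuclideanSpace ℝ (Fin 3)) (c : EuclideanSpace ℝ (Fin 3)),
          IsAxisymmetric (fun y => L.symm (v s (L y + c))) ∧ HasNoSwirl (fun y => L.symm (v s (L y + c)))) ∨
        (∃ (k : ℝ) (c d : EuclideanSpace ℝ (Fin 3)) (h : ℝ) (U : Set (EuclideanSpace ℝ (Fin 3))),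
          k ≠ 0 ∧ d ≠ 0 ∧ IsOpen U ∧ U.Nonempty ∧
            ∀ y ∈ U, curl (v s) y = k • (cross d (y - c) + h • d)) := by
  intro H
  obtain ⟨s, hs, halt⟩ := H 4 driftProfile
    ⟨hasTypeITimeDecay_driftProfile, continuousOn_driftProfile, fun t _ => isDivFree_driftProfile t,
      fun s _ y => helicityFree_driftProfile s y⟩
  rcases halt with h1 | h2 | ⟨L, c, -, hns⟩ | h4
  · exact driftProfile_no_aligned_no_translationInvariant_slice ⟨s, hs, Or.inl h1⟩
  · exact driftProfile_no_aligned_no_translationInvariant_slice ⟨s, hs, Or.inr h2⟩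
  · exact driftProfile_swirl_every_axis hs L c hns
  · exact driftProfile_no_affineScrew_vorticity_ball hs h4

end Summit.NavierStokesRegularity.NavierStokesRegularity.Theorems.PoloidalWindowRigidity.Negative

end
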